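import Literature.MathematicalPhysics.QuantumFieldTheory.Balaban1983to89.TreeLengthTorusTransfer
import Literature.MathematicalPhysics.QuantumFieldTheory.Balaban1983to89.TreeLengthDichotomy

/-!
# NODE O port PT-A — `stub_G3C` helper (leaves (α)(γ), any edition): PIECES STICKING OUT OF THE ENLARGED CUBE ARE UNIFORMLY SMALL — on the torus catalogue `𝐃_j`, a domain `X ∋ □`
# not contained in `□̃ = tblock □` has linear size `d_j(X) ≥ 1`, hence `Σ_{X ∋ □, X ⊄ □̃} e^{−δ·d_j(X)} ≤ e^{−(δ−κ)}·K₀` for `kappa₀ ≤ κ ≤ δ` ((1.26) on the torus)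

Cell `ym-nodeO-ideate`, porter hand `hand-27930-G3C` (g0); proof kind, `--supports stmt-QuantumFields-27930 --as helper` (count-neutral).  [I] = [Balaban1987RG1], [II] = [Balaban1988RG2Cluster],
[16] = [Balaban1985UV3].

WHY.  In every parametrix∕walk edition of the resolvent member of [16] (63) at a field-localized carrier `T = Σ_Y T_Y` (the current `G3CAtRecord` or the repaired `G3CAtRecordL`, see the hand's
`G3C-OBSTRUCTION-v1.md` §5 (D)(α)) the local inverse of cube `□` is built from the pieces `T_Y` with `Y ⊆ □̃`; the pieces with `Y ∋ □`, `Y ⊄ □̃` are expanded perturbatively and must be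
UNIFORMLY SMALL.  Under the P0-ℂ body's (P4) `‖T_Y‖ ≤ c₀·e^{−δ₀·d_j(Y)}` this is exactly the statement that such `Y` have `d_j(Y) ≥ 1` (so `δ₀ ≥ δG` makes them small) together with the animal
bound (1.26): this file proves both on the torus model of record (`TreeLengthTorus.torusTreeLen`, `tblock`).

WHAT THIS FILE PROVES (sorry-free; torus geometry over `TPt d N`, `[NeZero N]`):
* `exists_far_coord_of_not_mem_tblock` — if `b ∉ tblock a` then ANY lifts `x` of `a` and `y` of `b` are two apart in some coordinate (`x μ + 2 ≤ y μ ∨ y μ + 2 ≤ x μ`).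
* `one_le_len_of_tAdmissible_of_not_mem_tblock` — every `TAdmissible` graph of an `X ∋ a, b` with `b ∉ tblock a` has length `≥ 1` (capture lemma ✓`TreeLength.le_lenIn_closedBall`).
* ★ `one_le_torusTreeLen_of_not_subset_tblock` — `X ∈ 𝐃` (non-empty, wall-connected), `a ∈ X`, `X ⊄ tblock a` ⟹ `1 ≤ torusTreeLen X` (the torus twin of ✓`TreeLengthDichotomy.one_le_treeLen_of_far`).
* ★ `sum_exp_stickOut_le` — `Σ_{X : a ∈ X, X wall-connected, X ⊄ tblock a} e^{−δ·torusTreeLen X} ≤ e^{−(δ−κ)}·K₀(4·2^d, 2d)` for `kappa₀(4·2^d, 2d) ≤ κ ≤ δ` (✓`TreeLengthTorus.sum_exp_torusTreeLen_le`).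

HONEST FRAMING.  Torus combinatorics∕geometry of the tree's MODEL of `d_j`; nothing of Bałaban's estimates asserted, ported or discharged; `stub_G3C` NOT closed (mis-cut verdict stands); 27930 OPEN;
NODE O 0∕1; COUNT 8∕28 · K 1∕4 UNMOVED; finite `𝕋⁴` at fixed ε — NOT continuum ∕ OS ∕ Clay; **the Yang–Mills mass gap is NOT proved by any of this.**  No `sorry`, no `instance`, no `notation`,
no `def`; standard axioms.
-/

noncomputable section

open scoped BigOperators
open Finset

namespace Summit.QuantumFields.YangMills.Theorems.BalabanUVNodesPortS1.G3CGeom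

open Literature.MathematicalPhysics.QuantumFieldTheory.Balaban1983to89
open Literature.MathematicalPhysics.QuantumFieldTheory.Balaban1983to89.TreeLength
open Literature.MathematicalPhysics.QuantumFieldTheory.Balaban1983to89.TreeLengthTorus
open Literature.MathematicalPhysics.QuantumFieldTheory.Balaban1983to89.TreeLengthTorusGeometry
open Literature.MathematicalPhysics.QuantumFieldTheory.Balaban1983to89.TreeLengthTorusTransfer
open Literature.MathematicalPhysics.QuantumFieldTheory.Balaban1983to89.B13ScaleTransfer (Pt block mem_block)
open Literature.MathematicalPhysics.QuantumFieldTheory.Balaban1983to89.B13Geometry236 (lenIn_le_len)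
open Literature.MathematicalPhysics.QuantumFieldTheory.Balaban1983to89.B12TreeDecay (K₀ kappa₀)

variable {d N : ℕ} [NeZero N]

/-- **Off the enlarged cube means two apart in the cover**: if `b ∉ tblock a`, every lift `x` of `a` and every lift `y` of `b` satisfy `x μ + 2 ≤ y μ` or `y μ + 2 ≤ x μ` for some `μ`.
[cite: Balaban1987RG1, p.257 (definition of □̃)] -/
theorem exists_far_coord_of_not_mem_tblock {a b : TPt d N} (h : b ∉ tblock a) {x y : Pt d} (hx : proj N x = a) (hy : proj N y = b) :
    ∃ μ : Fin d, x μ + 2 ≤ y μ ∨ y μ + 2 ≤ x μ := by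
  by_contra hcon
  push Not at hcon
  apply h
  -- `x = natLift a + N·k`; translate `y` back by the same period into the window block of `natLift a`
  obtain ⟨k, hk⟩ := exists_period_of_proj_eq (N := N) (x := natLift a) (y := x) (by rw [proj_natLift, hx])
  refine Finset.mem_image.2 ⟨y - period N k, ?_, ?_⟩
  · rw [mem_block]
    intro i
    have h1 := hcon i
    have hxi : x i = natLift a i + period N k i := by rw [hk]; rfl
    simp only [Pi.sub_apply]
    constructor <;> omega
  · have e : y - period N k = y + period N (-k) := by
      ext i; simp [period]; ring
    rw [e, proj_add_period, hy]

/-- **Capture**: a `TAdmissible` graph of `X ∋ a, b` with `b ∉ tblock a` has length `≥ 1` — it meets a lift cube of `a` and one of `b`, two apart in some coordinate, so it joins two points at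
distance `≥ 1`. [folklore] -/
theorem one_le_len_of_tAdmissible_of_not_mem_tblock {X : Finset (TPt d N)} {T : List (Seg d)} (hT : TAdmissible X T) {a b : TPt d N}
    (ha : a ∈ X) (hb : b ∈ X) (h : b ∉ tblock a) : 1 ≤ len T := by
  obtain ⟨x, hx, p, hpT, hpx⟩ := hT.meets a ha
  obtain ⟨y, hy, q, hqT, hqy⟩ := hT.meets b hb
  obtain ⟨μ, hμ⟩ := exists_far_coord_of_not_mem_tblock h hx hy
  have hpμ := mem_cube.1 hpx μ
  have hqμ := mem_cube.1 hqy μ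
  have hdist : (1 : ℝ) ≤ dist p q := by
    refine le_trans ?_ (dist_le_pi_dist p q μ)
    rw [Real.dist_eq]
    rcases hμ with hμ | hμ
    · have hc : ((x μ : ℤ) : ℝ) + 2 ≤ (y μ : ℝ) := by exact_mod_cast hμ
      rw [abs_sub_comm, abs_of_nonneg (by linarith)]
      linarith
    · have hc : ((y μ : ℤ) : ℝ) + 2 ≤ (x μ : ℝ) := by exact_mod_cast hμ
      rw [abs_of_nonneg (by linarith)]
      linarith
  calc (1 : ℝ) ≤ lenIn (Metric.closedBall p 1) T := le_lenIn_closedBall hT.connected.isPreconnected hpT hqT one_pos hdist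
    _ ≤ len T := lenIn_le_len _ T

/-- A wall-connected `X ∋ a, b` with `b ∉ tblock a` has `torusTreeLen X ≥ 1`. [folklore] -/
theorem one_le_torusTreeLen_of_not_mem_tblock {X : Finset (TPt d N)} (hc : TFaceConnected X) {a b : TPt d N} (ha : a ∈ X) (hb : b ∈ X)
    (h : b ∉ tblock a) : 1 ≤ torusTreeLen X :=
  le_torusTreeLen ((exists_tAdmissible ⟨a, ha⟩ hc).imp fun _ hT => hT.1) fun _ hT => one_le_len_of_tAdmissible_of_not_mem_tblock hT ha hb h

/-- ★ **A domain sticking out of the enlarged cube has linear size at least one**: `X` wall-connected, `a ∈ X`, `X ⊄ tblock a` ⟹ `1 ≤ torusTreeLen X` (torus twin of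
✓`TreeLengthDichotomy.one_le_treeLen_of_far`). [cite: Balaban1987RG1, p.257 (linear size d_j, □̃); Balaban1988RG2Cluster, (2.30) p.18] -/
theorem one_le_torusTreeLen_of_not_subset_tblock {X : Finset (TPt d N)} (hc : TFaceConnected X) {a : TPt d N} (ha : a ∈ X) (h : ¬ X ⊆ tblock a) :
    1 ≤ torusTreeLen X := by
  obtain ⟨b, hb, hbt⟩ := Finset.not_subset.1 h
  exact one_le_torusTreeLen_of_not_mem_tblock hc ha hb hbt

open scoped Classical in
/-- ★ **THE STICKING-OUT SUM** ((1.26) on the torus with one unit of linear size pulled out): for `kappa₀(4·2^d, 2d) ≤ κ ≤ δ` and every cube `a`,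
`Σ_{X : a ∈ X, X wall-connected, X ⊄ tblock a} e^{−δ·torusTreeLen X} ≤ e^{−(δ−κ)}·K₀(4·2^d, 2d)` — with the P0-ℂ body's (P4) `‖T_Y‖ ≤ c₀e^{−δ₀ d_j(Y)}` this makes the pieces sticking out of `□̃`
uniformly small once `δ₀` is large. [cite: Balaban1988RG2Cluster, (1.26) p.8; Balaban1987RG1, p.257 (□̃)] -/
theorem sum_exp_stickOut_le (a : TPt d N) {κ δ : ℝ} (hκ : kappa₀ (4 * 2 ^ d) (2 * d) ≤ κ) (hδ : κ ≤ δ) :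
    ∑ X ∈ (Finset.univ : Finset (Finset (TPt d N))).filter (fun X => a ∈ X ∧ TFaceConnected X ∧ ¬ X ⊆ tblock a),
        Real.exp (-(δ * torusTreeLen X)) ≤ Real.exp (-(δ - κ)) * K₀ (4 * 2 ^ d) (2 * d) := by
  have hterm : ∀ X ∈ (Finset.univ : Finset (Finset (TPt d N))).filter (fun X => a ∈ X ∧ TFaceConnected X ∧ ¬ X ⊆ tblock a),
      Real.exp (-(δ * torusTreeLen X)) ≤ Real.exp (-(δ - κ)) * Real.exp (-κ * torusTreeLen X) := by
    intro X hX
    rw [Finset.mem_filter] at hX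
    have h1 : 1 ≤ torusTreeLen X := one_le_torusTreeLen_of_not_subset_tblock hX.2.2.1 hX.2.1 hX.2.2.2
    rw [← Real.exp_add]
    apply Real.exp_le_exp.2
    nlinarith
  have hsub : (Finset.univ : Finset (Finset (TPt d N))).filter (fun X => a ∈ X ∧ TFaceConnected X ∧ ¬ X ⊆ tblock a) ⊆
      (Finset.univ : Finset (Finset (TPt d N))).filter (fun X => a ∈ X ∧ TFaceConnected X) := by
    intro X hX
    rw [Finset.mem_filter] at hX ⊢
    exact ⟨hX.1, hX.2.1, hX.2.2.1⟩
  calc ∑ X ∈ (Finset.univ : Finset (Finset (TPt d N))).filter (fun X => a ∈ X ∧ TFaceConnected X ∧ ¬ X ⊆ tblock a), Real.exp (-(δ * torusTreeLen X))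
      ≤ ∑ X ∈ (Finset.univ : Finset (Finset (TPt d N))).filter (fun X => a ∈ X ∧ TFaceConnected X ∧ ¬ X ⊆ tblock a),
          Real.exp (-(δ - κ)) * Real.exp (-κ * torusTreeLen X) := Finset.sum_le_sum hterm
    _ = Real.exp (-(δ - κ)) * ∑ X ∈ (Finset.univ : Finset (Finset (TPt d N))).filter (fun X => a ∈ X ∧ TFaceConnected X ∧ ¬ X ⊆ tblock a),
          Real.exp (-κ * torusTreeLen X) := by rw [Finset.mul_sum]
    _ ≤ Real.exp (-(δ - κ)) * ∑ X ∈ (Finset.univ : Finset (Finset (TPt d N))).filter (fun X => a ∈ X ∧ TFaceConnected X),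
          Real.exp (-κ * torusTreeLen X) :=
        mul_le_mul_of_nonneg_left (Finset.sum_le_sum_of_subset_of_nonneg hsub fun _ _ _ => (Real.exp_pos _).le) (Real.exp_pos _).le
    _ ≤ Real.exp (-(δ - κ)) * K₀ (4 * 2 ^ d) (2 * d) := mul_le_mul_of_nonneg_left (sum_exp_torusTreeLen_le d N a hκ) (Real.exp_pos _).le

/-! ## Addendum (hand g0): small domains sit inside every member's block; small sticking-out domains avoid the inner block (memo §5b (ii)) -/

/-- **A domain of linear size `< 1` lies in the block of each of its cubes**: `torusTreeLen X < 1`, `a ∈ X` ⟹ `X ⊆ tblock a` (contrapositive of `one_le_torusTreeLen_of_not_subset_tblock`).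
[cite: Balaban1987RG1, p.257 (□̃, d_j)] -/
theorem subset_tblock_of_torusTreeLen_lt_one {X : Finset (TPt d N)} (hc : TFaceConnected X) {a : TPt d N} (ha : a ∈ X) (h : torusTreeLen X < 1) :
    X ⊆ tblock a := by
  by_contra hX
  exact absurd (one_le_torusTreeLen_of_not_subset_tblock hc ha hX) (not_le.2 h)

/-- ★ **Small domains sticking out of the `5^d` block avoid the `3^d` block**: if `torusTreeLen X < 1` and `X ⊄ tcollar (tblock q)` (`= ⋃_{c ∈ tblock q} tblock c`), then NO cube of `X` lies in
`tblock q` — so in the one-sided parametrix with local blocks `tcollar (tblock □)` the `d_j = 0` sticking-out pieces only read resolvent entries between `□` and cubes at sup-distance `≥ 2`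
(one full cube of lattice distance: the Combes–Thomas factor `e^{−κ·L·Mc}` of ✓`…G3CResolvent`). [cite: Balaban1987RG1, p.257 (□̃, X̃); Balaban1985BackgroundPropagators, (3.94) p.410] -/
theorem not_mem_tblock_of_small_of_not_subset_tcollar {X : Finset (TPt d N)} (hc : TFaceConnected X) (h : torusTreeLen X < 1) {q : TPt d N}
    (hX : ¬ X ⊆ tcollar (tblock q)) {c : TPt d N} (hcX : c ∈ X) : c ∉ tblock q := by
  intro hcq
  exact hX ((subset_tblock_of_torusTreeLen_lt_one hc hcX h).trans (tblock_subset_tcollar hcq))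

/-- The dichotomy used by the walk bound: a wall-connected `X` meeting the remainder of cube `q` (i.e. `X ⊄ tcollar (tblock q)`) either has `torusTreeLen X ≥ 1` (small by `δ₀`) or avoids `tblock q`
(small by Combes–Thomas). [folklore] -/
theorem one_le_torusTreeLen_or_avoids_tblock {X : Finset (TPt d N)} (hc : TFaceConnected X) {q : TPt d N} (hX : ¬ X ⊆ tcollar (tblock q)) :
    1 ≤ torusTreeLen X ∨ ∀ c ∈ X, c ∉ tblock q := by
  by_cases h : torusTreeLen X < 1
  · exact Or.inr fun c hcX => not_mem_tblock_of_small_of_not_subset_tcollar hc h hX hcX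
  · exact Or.inl (not_lt.1 h)

end Summit.QuantumFields.YangMills.Theorems.BalabanUVNodesPortS1.G3CGeom

end
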